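import Literature.NumberTheory.Automorphic.AdelicRationalVectorCount
import HarnessLib

/-!
# Continuity, support and archimedean decay of standard Schwartz–Bruhat functions on `𝔸_Kⁿ`

Topic `NumberTheory/Automorphic`; namespace `Literature.NumberTheory.Automorphic`. Proof file
(theorems only) for the generators `Φ(x) = Φ_∞(x_∞) Φ_f(x_f)` of the Schwartz–Bruhat space
`𝒮(𝔸_Kⁿ) = adelicSchwartzBruhat K n` of `MirabolicEisensteinSeries` (`IsStandardSchwartzBruhat`:
`Φ_∞ = ∏_{w ∣ ∞} Φ_w`, `Φ_w` Schwartz on `K_wⁿ`; `Φ_f` locally constant with compact support):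

* `IsStandardSchwartzBruhat.continuous` — `Φ` is continuous;
* `IsStandardSchwartzBruhat.exists_isCompact_eq_zero` — `Φ(x) = 0` unless `x_f` lies in a fixed
  compact set of finite-adelic vectors;
* `IsStandardSchwartzBruhat.exists_norm_le_rpow_neg` — **archimedean decay of every order**:
  for each `k`, `|Φ(x)| ≤ M_k (1 + ‖x_∞‖)^{-k}` (`x_∞ = vecInfinitePart K n x` with the sup norm of
  `(K ⊗ ℝ)ⁿ`; Mathlib's `SchwartzMap.one_add_le_sup_seminorm_apply` at each archimedean place and
  `1 + ‖x_∞‖ ≤ ∏_w (1 + ‖x_w‖)`, `one_add_norm_le_prod`).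

These are the properties of `Φ` used in the proof of the absolute convergence of the mirabolic
Eisenstein series (Jacquet–Shalika (1981), §4; Godement–Jacquet, LNM 260, §11). Folklore.

## References

* D. Bump, *Automorphic Forms and Representations* (1997), §3.1 [Bump1997].
* R. Godement, H. Jacquet, *Zeta functions of simple algebras*, LNM 260 (1972), §11
  [GodementJacquetLNM260].
-/

noncomputable section

open scoped NNReal ENNReal Classical
open NumberField NumberField.mixedEmbedding NumberField.InfinitePlace IsDedekindDomain Set

namespace Literature.NumberTheory.Automorphic

/-! ### An inequality for sup norms on `(K ⊗ ℝ)ⁿ` -/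

section SupNorm

/-- If all `f j ≥ 1` then `f i ≤ ∏_j f j` (reals). [folklore] -/
theorem le_prod_of_forall_one_le {ι : Type*} [Fintype ι] {f : ι → ℝ} (hf : ∀ i, 1 ≤ f i)
    (i : ι) : f i ≤ ∏ j, f j := by
  rw [← Finset.mul_prod_erase Finset.univ f (Finset.mem_univ i)]
  exact le_mul_of_one_le_right (zero_le_one.trans (hf i))
    (Finset.one_le_prod fun j _ => hf j)

variable (K : Type) [Field K] [NumberField K] {n : ℕ}

/-- **`1 + ‖y‖ ≤ ∏_{w real} (1 + ‖y_w‖) · ∏_{w complex} (1 + ‖y_w‖)`** for `y ∈ (K ⊗ ℝ)ⁿ` with the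
sup norm, `y_w = (y_{i,w})_i` the block of coordinates at the place `w` (the sup is attained at
some place, and all factors are `≥ 1`). [folklore] -/
theorem one_add_norm_le_prod (y : Fin n → mixedSpace K) :
    1 + ‖y‖ ≤ (∏ w : {w : InfinitePlace K // w.IsReal}, (1 + ‖fun i => (y i).1 w‖)) *
      ∏ w : {w : InfinitePlace K // w.IsComplex}, (1 + ‖fun i => (y i).2 w‖) := by
  set Pr : ℝ := ∏ w : {w : InfinitePlace K // w.IsReal}, (1 + ‖fun i => (y i).1 w‖) with hPr
  set Pc : ℝ := ∏ w : {w : InfinitePlace K // w.IsComplex}, (1 + ‖fun i => (y i).2 w‖) with hPc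
  have hr1 : ∀ w : {w : InfinitePlace K // w.IsReal}, (1 : ℝ) ≤ 1 + ‖fun i => (y i).1 w‖ :=
    fun w => le_add_of_nonneg_right (norm_nonneg _)
  have hc1 : ∀ w : {w : InfinitePlace K // w.IsComplex}, (1 : ℝ) ≤ 1 + ‖fun i => (y i).2 w‖ :=
    fun w => le_add_of_nonneg_right (norm_nonneg _)
  have hPr1 : 1 ≤ Pr := Finset.one_le_prod fun w _ => hr1 w
  have hPc1 : 1 ≤ Pc := Finset.one_le_prod fun w _ => hc1 w
  have hPrle : Pr ≤ Pr * Pc := le_mul_of_one_le_right (zero_le_one.trans hPr1) hPc1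
  have hPcle : Pc ≤ Pr * Pc := le_mul_of_one_le_left (zero_le_one.trans hPc1) hPr1
  have hP1 : 1 ≤ Pr * Pc := one_le_mul_of_one_le_of_one_le hPr1 hPc1
  rw [add_comm, ← le_sub_iff_add_le]
  refine (pi_norm_le_iff_of_nonneg (by linarith)).2 fun i => ?_
  rw [Prod.norm_def]
  refine max_le ?_ ?_
  · refine (pi_norm_le_iff_of_nonneg (by linarith)).2 fun w => ?_
    have h1 : ‖(y i).1 w‖ ≤ ‖fun i => (y i).1 w‖ := norm_le_pi_norm (fun i => (y i).1 w) i
    have h2 := le_prod_of_forall_one_le hr1 w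
    linarith
  · refine (pi_norm_le_iff_of_nonneg (by linarith)).2 fun w => ?_
    have h1 : ‖(y i).2 w‖ ≤ ‖fun i => (y i).2 w‖ := norm_le_pi_norm (fun i => (y i).2 w) i
    have h2 := le_prod_of_forall_one_le hc1 w
    linarith

end SupNorm

/-! ### Standard Schwartz–Bruhat functions -/

section Standard

variable (K : Type) [Field K] [NumberField K] {n : ℕ}

/-- `x ↦ x_∞` is continuous. [folklore] -/
theorem continuous_vecInfinitePart : Continuous (vecInfinitePart K n) :=
  continuous_pi fun i =>
    (continuous_ringEquiv_mixedSpace K).comp (continuous_fst.comp (continuous_apply i))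

/-- `x ↦ x_f` is continuous. [folklore] -/
theorem continuous_vecFinitePart : Continuous (vecFinitePart K n) :=
  continuous_pi fun i => continuous_snd.comp (continuous_apply i)

/-- A factorizable archimedean Schwartz function is continuous. [folklore] -/
theorem continuous_archSchwartzFun
    (Φr : {w : InfinitePlace K // w.IsReal} → SchwartzMap (Fin n → ℝ) ℂ)
    (Φc : {w : InfinitePlace K // w.IsComplex} → SchwartzMap (Fin n → ℂ) ℂ) :
    Continuous (archSchwartzFun K n Φr Φc) := by
  unfold archSchwartzFun
  refine (continuous_finsetProd _ fun w _ => ?_).mul (continuous_finsetProd _ fun w _ => ?_)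
  · exact (Φr w).continuous.comp (continuous_pi fun i =>
      (continuous_apply w).comp (continuous_fst.comp (continuous_apply i)))
  · exact (Φc w).continuous.comp (continuous_pi fun i =>
      (continuous_apply w).comp (continuous_snd.comp (continuous_apply i)))

variable {K}

/-- **Standard Schwartz–Bruhat functions are continuous** (Schwartz functions are continuous, and
a locally constant function is continuous). [folklore] -/
theorem IsStandardSchwartzBruhat.continuous {Φ : (Fin n → AdeleRing (𝓞 K) K) → ℂ}
    (hΦ : IsStandardSchwartzBruhat K n Φ) : Continuous Φ := by
  obtain ⟨Φr, Φc, Φf, hΦf, rfl⟩ := hΦ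
  exact ((continuous_archSchwartzFun K Φr Φc).comp (continuous_vecInfinitePart K)).mul
    (hΦf.1.continuous.comp (continuous_vecFinitePart K))

/-- **Compact support in the finite-adelic variable**: a standard Schwartz–Bruhat function
vanishes unless `x_f` lies in a fixed compact set (the support of `Φ_f`). [folklore] -/
theorem IsStandardSchwartzBruhat.exists_isCompact_eq_zero {Φ : (Fin n → AdeleRing (𝓞 K) K) → ℂ}
    (hΦ : IsStandardSchwartzBruhat K n Φ) :
    ∃ C : Set (Fin n → FiniteAdeleRing (𝓞 K) K), IsCompact C ∧
      ∀ x, vecFinitePart K n x ∉ C → Φ x = 0 := by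
  obtain ⟨Φr, Φc, Φf, hΦf, rfl⟩ := hΦ
  exact ⟨tsupport Φf, hΦf.2, fun x hx => by
    simp only [image_eq_zero_of_notMem_tsupport hx, mul_zero]⟩

/-- The Schwartz decay of one factor: `‖f(z)‖ ≤ 2^k p_k(f) (1 + ‖z‖)^{-k}` with `p_k` the sup of
the Schwartz seminorms of index `≤ (k, 0)` (Mathlib's `SchwartzMap.one_add_le_sup_seminorm_apply`).
[folklore] -/
theorem SchwartzMap.norm_le_mul_one_add_norm_rpow_neg {E : Type*} [NormedAddCommGroup E]
    [NormedSpace ℝ E] (f : SchwartzMap E ℂ) (k : ℕ) (z : E) :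
    ‖f z‖ ≤ 2 ^ k * (Finset.Iic (k, 0)).sup (fun m => SchwartzMap.seminorm ℝ m.1 m.2) f *
      (1 + ‖z‖) ^ (-(k : ℝ)) := by
  have h := SchwartzMap.one_add_le_sup_seminorm_apply (𝕜 := ℝ) (m := (k, 0)) le_rfl le_rfl f z
  rw [norm_iteratedFDeriv_zero] at h
  have hpos : 0 < 1 + ‖z‖ := by positivity
  rw [Real.rpow_neg hpos.le, Real.rpow_natCast, ← div_eq_mul_inv, le_div_iff₀ (pow_pos hpos k),
    mul_comm]
  exact h

/-- **Archimedean decay of every order.** For a standard Schwartz–Bruhat function `Φ` on `𝔸_Kⁿ`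
and every `k ∈ ℕ` there is `M ≥ 0` with `|Φ(x)| ≤ M (1 + ‖x_∞‖)^{-k}` for all `x`
(`x_∞ = vecInfinitePart K n x`, sup norm on `(K ⊗ ℝ)ⁿ`): each factor `Φ_w` decays like
`(1 + ‖x_w‖)^{-k}`, `Φ_f` is bounded, and `1 + ‖x_∞‖ ≤ ∏_w (1 + ‖x_w‖)`. (Bump (1997), §3.1;
Godement–Jacquet (1972), §11.) [cite: Bump1997, §3.1] -/
theorem IsStandardSchwartzBruhat.exists_norm_le_rpow_neg {Φ : (Fin n → AdeleRing (𝓞 K) K) → ℂ}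
    (hΦ : IsStandardSchwartzBruhat K n Φ) (k : ℕ) :
    ∃ M : ℝ, 0 ≤ M ∧ ∀ x, ‖Φ x‖ ≤ M * (1 + ‖vecInfinitePart K n x‖) ^ (-(k : ℝ)) := by
  obtain ⟨Φr, Φc, Φf, hΦf, rfl⟩ := hΦ
  obtain ⟨Mf, hMf⟩ := (hΦf.1.continuous).bounded_above_of_compact_support hΦf.2
  have hMf0 : 0 ≤ Mf := (norm_nonneg _).trans (hMf 0)
  -- the constants at the archimedean places
  set Br : {w : InfinitePlace K // w.IsReal} → ℝ := fun w =>
    2 ^ k * (Finset.Iic (k, 0)).sup (fun m => SchwartzMap.seminorm ℝ m.1 m.2) (Φr w) with hBr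
  set Bc : {w : InfinitePlace K // w.IsComplex} → ℝ := fun w =>
    2 ^ k * (Finset.Iic (k, 0)).sup (fun m => SchwartzMap.seminorm ℝ m.1 m.2) (Φc w) with hBc
  have hBr0 : ∀ w, 0 ≤ Br w := fun w => mul_nonneg (by positivity) (apply_nonneg _ _)
  have hBc0 : ∀ w, 0 ≤ Bc w := fun w => mul_nonneg (by positivity) (apply_nonneg _ _)
  have hBr1 : 0 ≤ ∏ w, Br w := Finset.prod_nonneg fun w _ => hBr0 w
  have hBc1 : 0 ≤ ∏ w, Bc w := Finset.prod_nonneg fun w _ => hBc0 w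
  refine ⟨(∏ w, Br w) * (∏ w, Bc w) * Mf, mul_nonneg (mul_nonneg hBr1 hBc1) hMf0, fun x => ?_⟩
  set y : Fin n → mixedSpace K := vecInfinitePart K n x with hy
  set Pr : ℝ := ∏ w : {w : InfinitePlace K // w.IsReal}, (1 + ‖fun i => (y i).1 w‖) with hPr
  set Pc : ℝ := ∏ w : {w : InfinitePlace K // w.IsComplex}, (1 + ‖fun i => (y i).2 w‖) with hPc
  have hPr0 : 0 < Pr := Finset.prod_pos fun w _ => by positivity
  have hPc0 : 0 < Pc := Finset.prod_pos fun w _ => by positivity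
  -- the two archimedean products
  have h1 : ‖∏ w, Φr w fun i => (y i).1 w‖ ≤ (∏ w, Br w) * Pr ^ (-(k : ℝ)) := by
    rw [norm_prod]
    calc ∏ w, ‖Φr w fun i => (y i).1 w‖
        ≤ ∏ w, Br w * (1 + ‖fun i => (y i).1 w‖) ^ (-(k : ℝ)) :=
          Finset.prod_le_prod (fun w _ => norm_nonneg _) fun w _ =>
            SchwartzMap.norm_le_mul_one_add_norm_rpow_neg (Φr w) k _
      _ = (∏ w, Br w) * Pr ^ (-(k : ℝ)) := by
          rw [Finset.prod_mul_distrib, Real.finsetProd_rpow _ _ fun w _ => by positivity]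
  have h2 : ‖∏ w, Φc w fun i => (y i).2 w‖ ≤ (∏ w, Bc w) * Pc ^ (-(k : ℝ)) := by
    rw [norm_prod]
    calc ∏ w, ‖Φc w fun i => (y i).2 w‖
        ≤ ∏ w, Bc w * (1 + ‖fun i => (y i).2 w‖) ^ (-(k : ℝ)) :=
          Finset.prod_le_prod (fun w _ => norm_nonneg _) fun w _ =>
            SchwartzMap.norm_le_mul_one_add_norm_rpow_neg (Φc w) k _
      _ = (∏ w, Bc w) * Pc ^ (-(k : ℝ)) := by
          rw [Finset.prod_mul_distrib, Real.finsetProd_rpow _ _ fun w _ => by positivity]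
  -- `(Pr Pc)^{-k} ≤ (1 + ‖y‖)^{-k}`
  have hdecay : Pr ^ (-(k : ℝ)) * Pc ^ (-(k : ℝ)) ≤ (1 + ‖y‖) ^ (-(k : ℝ)) := by
    rw [← Real.mul_rpow hPr0.le hPc0.le]
    exact Real.rpow_le_rpow_of_nonpos (by positivity) (one_add_norm_le_prod K y)
      (neg_nonpos.2 (Nat.cast_nonneg k))
  have hA : 0 ≤ (∏ w, Br w) * Pr ^ (-(k : ℝ)) := mul_nonneg hBr1 (Real.rpow_nonneg hPr0.le _)
  have hB : 0 ≤ (∏ w, Bc w) * Pc ^ (-(k : ℝ)) := mul_nonneg hBc1 (Real.rpow_nonneg hPc0.le _)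
  calc ‖archSchwartzFun K n Φr Φc (vecInfinitePart K n x) * Φf (vecFinitePart K n x)‖
      = ‖∏ w, Φr w fun i => (y i).1 w‖ * ‖∏ w, Φc w fun i => (y i).2 w‖ *
          ‖Φf (vecFinitePart K n x)‖ := by
        rw [norm_mul, archSchwartzFun, norm_mul]
    _ ≤ ((∏ w, Br w) * Pr ^ (-(k : ℝ))) * ((∏ w, Bc w) * Pc ^ (-(k : ℝ))) * Mf :=
        mul_le_mul (mul_le_mul h1 h2 (norm_nonneg _) hA) (hMf _) (norm_nonneg _)
          (mul_nonneg hA hB)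
    _ = (∏ w, Br w) * (∏ w, Bc w) * Mf * (Pr ^ (-(k : ℝ)) * Pc ^ (-(k : ℝ))) := by ring
    _ ≤ (∏ w, Br w) * (∏ w, Bc w) * Mf * (1 + ‖y‖) ^ (-(k : ℝ)) :=
        mul_le_mul_of_nonneg_left hdecay (mul_nonneg (mul_nonneg hBr1 hBc1) hMf0)

end Standard

end Literature.NumberTheory.Automorphic
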